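import Summits.ResolutionOfSingularities.ResolutionOfSingularities.Theorems.FrobeniusLadderFInjectiveMacaulayficationX2Cubic4Specimen
import Summits.ResolutionOfSingularities.ResolutionOfSingularities.Theorems.FrobeniusLadderFInjectiveMacaulayficationCensusBedsWeaklyNondegenerate
import HarnessLib

/-!
# THE BRIESKORN–PHAM FAMILY `z^c + x^{a₀} + y^{a₁} + u^{a₂} + t^{a₃}` (`2 ≤ c < a_j`; `a_j ≠ 0` in `k`; NO hypothesis on `c` mod `p`): SPECIMEN PACKAGE — prime,
# convenient, weakly non-degenerate, no variable vanishes, vertex singular, regular off the vertex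
# (crux `FInjectiveMacaulayfication` stmt-ResolutionOfSingularities-15315, chain w45a; res-L1-w45a-plan-1 RULING R22.12 (ii) «the BRIESKORN–PHAM CONDITIONAL CLASS ROW:
# f = X₄^c + ΣX_i^{a} (2 ≤ c < a, …, primality/isolatedness hypotheses as the algebra dictates) over `F108Consumable k 5` … extends the conditional class level from
# double points to the triple/quadruple-point beds»; seat res-L1-w45a-stub-1 g14; template = ✓ `DiagonalSqSpecimen` (`c = 2`, equal exponents) with the multiplicity `c`
# and the exponent vector made symbolic)

[OURS · L1 W4.5a] Support file (`--supports stmt-ResolutionOfSingularities-15315 --as helper`); def-free, UNCONDITIONAL; replaces the role of NO printed item; NOT a statement of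
the manuscript; AI-written (AI review is weaker than expert review).

Letters: `X 0..X 3 = x,y,u,t`, `X 4 = z`, `f = X4^c + X0^{a₀} + X1^{a₁} + X2^{a₂} + X3^{a₃}`, `v` = the origin. Hypotheses as needed: `2 ≤ c`, `c < a_j` (so every `a_j ≥ 3`),
`(a_j : k) ≠ 0` for `j = 0,1,2,3`, and for primality a WITNESS `ω : k` with `ω^{a₁} + 1 = 0` (`ω = −1` when `a₁` is odd; any `k = k̄`). THE MULTIPLICITY `c` IS FREE: it may be
divisible by `p` (wild members `z^p + …`, `z^{2p} + …` are in the family) — the Jacobian argument never differentiates in `z`.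
* §1 `pderiv_four_f` (`c·z^{c−1}`), `pderiv_pow_f` (`a_j·X_j^{a_j−1}`, the four cases as a conjunction), `constantCoeff_f`, ★ `prime_f` (`T^c + C(s)`, `s = x^{a₀}+y^{a₁}+u^{a₂}+t^{a₃}`,
  Eisenstein-type at `(1, ω, 0, 0)`: `s = 1 + ω^{a₁} = 0`, `∂s/∂x = a₀ ≠ 0`; ✓ `irreducible_X_pow_add_C`), ★ `regular_off_vertex` (at a prime `P ⊉ 𝔪`: if some `X_j ∉ P`, `j ≤ 3`,
  then `∂f/∂X_j = a_j X_j^{a_j−1} ∉ P` — Jacobian; if `x,y,u,t ∈ P` then `f ∈ P` forces `z^c ∈ P`, `z ∈ P`, `𝔪 ≤ P` — excluded; NO use of `∂f/∂z`), `f_not_mem_span_X`,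
  `mk_X_ne_zero`, `vertex_not_mem_regularLocus` (`f(0) = 0`, `∇f(0) = 0` as `c ≥ 2`, `a_j ≥ 2`).
* §2 `eq_monomials` / `mem_support_f` (the support is the five pure powers), ★ `convenient_f` (every variable occurs as a pure power: the CONVENIENT hypothesis of
  ✓ `F108ClassRow.F108Consumable`), ★ `weaklyNondegenerate_f` — weakly (Tjurina) non-degenerate along EVERY positive weight by res-L1-w45a-stub-3ʼs good-support criterion
  ✓ `CensusBedsWeaklyNondegenerate.weaklyNondegenerate_of_good_support` (`β₀ = c·e_z` the exempt vertex — its partial `c z^{c−1}` may vanish identically when `p ∣ c`; good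
  exponents `a_j·e_j`, `j < 4`, private variables, `a_j ≠ 0` in `k`).
The floor side and the conditional row are the sequel `…BrieskornPhamRowOfF108`. [folklore mathematics, OURS as a certificate; cite: Hartshorne1977, I Thm. 5.1;
BoubakriGreuelMarkwig2010, §3 (p. 10)]
-/

-- single-problem summit: the doubled namespace component is forced
set_option linter.dupNamespace false

noncomputable section

namespace Summit.ResolutionOfSingularities.ResolutionOfSingularities.Theorems.FInjectiveMacaulayfication.BrieskornPhamSpecimen

open CategoryTheory CategoryTheory.Limits AlgebraicGeometry TopologicalSpace IsLocalRing MvPolynomial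
open Literature.AlgebraicGeometry.Resolution Literature.AlgebraicGeometry.Resolution.BoubakriGreuelMarkwig
open Summit.ResolutionOfSingularities.ResolutionOfSingularities.Theorems.FInjectiveMacaulayfication
open SliceableCentre GermForm GermOfGlobalBlowup FCentreE1RungZero X2Cubic4Specimen CensusBedsWeaklyNondegenerate

variable (k : Type) [Field k]

/-! ## §1 Derivatives, primality, regularity off the vertex -/

/-- `∂f/∂z = c·z^{c−1}`. [folklore] -/
theorem pderiv_four_f (c a₀ a₁ a₂ a₃ : ℕ) (f : MvPolynomial (Fin 5) k)
    (hf : f = X 4 ^ c + X 0 ^ a₀ + X 1 ^ a₁ + X 2 ^ a₂ + X 3 ^ a₃) : pderiv 4 f = (c : MvPolynomial (Fin 5) k) * X 4 ^ (c - 1) := by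
  rw [hf]
  simp only [map_add, pderiv_pow, pderiv_X_self, pderiv_X_of_ne (show (0 : Fin 5) ≠ 4 by decide),
    pderiv_X_of_ne (show (1 : Fin 5) ≠ 4 by decide), pderiv_X_of_ne (show (2 : Fin 5) ≠ 4 by decide),
    pderiv_X_of_ne (show (3 : Fin 5) ≠ 4 by decide), mul_zero, mul_one, add_zero]

/-- `∂f/∂X_j = a_j·X_j^{a_j−1}` for `j ∈ {0,1,2,3}` (the four cases). [folklore] -/
theorem pderiv_pow_f (c a₀ a₁ a₂ a₃ : ℕ) (f : MvPolynomial (Fin 5) k)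
    (hf : f = X 4 ^ c + X 0 ^ a₀ + X 1 ^ a₁ + X 2 ^ a₂ + X 3 ^ a₃) :
    pderiv 0 f = (a₀ : MvPolynomial (Fin 5) k) * X 0 ^ (a₀ - 1) ∧ pderiv 1 f = (a₁ : MvPolynomial (Fin 5) k) * X 1 ^ (a₁ - 1) ∧
      pderiv 2 f = (a₂ : MvPolynomial (Fin 5) k) * X 2 ^ (a₂ - 1) ∧ pderiv 3 f = (a₃ : MvPolynomial (Fin 5) k) * X 3 ^ (a₃ - 1) := by
  rw [hf]
  refine ⟨?_, ?_, ?_, ?_⟩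
  all_goals
    simp only [map_add, pderiv_pow, pderiv_X_self, pderiv_X_of_ne (show (4 : Fin 5) ≠ 0 by decide),
      pderiv_X_of_ne (show (1 : Fin 5) ≠ 0 by decide), pderiv_X_of_ne (show (2 : Fin 5) ≠ 0 by decide),
      pderiv_X_of_ne (show (3 : Fin 5) ≠ 0 by decide), pderiv_X_of_ne (show (4 : Fin 5) ≠ 1 by decide),
      pderiv_X_of_ne (show (0 : Fin 5) ≠ 1 by decide), pderiv_X_of_ne (show (2 : Fin 5) ≠ 1 by decide),
      pderiv_X_of_ne (show (3 : Fin 5) ≠ 1 by decide), pderiv_X_of_ne (show (4 : Fin 5) ≠ 2 by decide),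
      pderiv_X_of_ne (show (0 : Fin 5) ≠ 2 by decide), pderiv_X_of_ne (show (1 : Fin 5) ≠ 2 by decide),
      pderiv_X_of_ne (show (3 : Fin 5) ≠ 2 by decide), pderiv_X_of_ne (show (4 : Fin 5) ≠ 3 by decide),
      pderiv_X_of_ne (show (0 : Fin 5) ≠ 3 by decide), pderiv_X_of_ne (show (1 : Fin 5) ≠ 3 by decide),
      pderiv_X_of_ne (show (2 : Fin 5) ≠ 3 by decide), mul_zero, mul_one, zero_add, add_zero]

/-- `f` has no constant term (`c, a_j ≠ 0`). [folklore] -/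
theorem constantCoeff_f (c a₀ a₁ a₂ a₃ : ℕ) (hc : 2 ≤ c) (h₀ : c < a₀) (h₁ : c < a₁) (h₂ : c < a₂) (h₃ : c < a₃) (f : MvPolynomial (Fin 5) k)
    (hf : f = X 4 ^ c + X 0 ^ a₀ + X 1 ^ a₁ + X 2 ^ a₂ + X 3 ^ a₃) : constantCoeff f = 0 := by
  rw [hf]
  simp [constantCoeff_X, zero_pow (by omega : c ≠ 0), zero_pow (by omega : a₀ ≠ 0), zero_pow (by omega : a₁ ≠ 0), zero_pow (by omega : a₂ ≠ 0),
    zero_pow (by omega : a₃ ≠ 0)]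

/-- **`f = z^c + x^{a₀} + y^{a₁} + u^{a₂} + t^{a₃}` is PRIME** given `ω ∈ k` with `ω^{a₁} + 1 = 0` and `a₀ ≠ 0` in `k` (`c ≥ 1`, `a₂, a₃ ≥ 1`): as `T^c + C(s)` over `k[x,y,u,t]`
(`z ↦ T`), `s = x^{a₀} + y^{a₁} + u^{a₂} + t^{a₃}`, Eisenstein-type at the point `(1, ω, 0, 0)` where `s = 1 + ω^{a₁} = 0` and `∂s/∂x = a₀ ≠ 0` (✓ `irreducible_X_pow_add_C`). No hypothesis
on `c` modulo the characteristic. [folklore] -/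
theorem prime_f (c a₀ a₁ a₂ a₃ : ℕ) (hc : 2 ≤ c) (h₂ : c < a₂) (h₃ : c < a₃) (ha₀ : ((a₀ : ℕ) : k) ≠ 0) (ω : k) (hω : ω ^ a₁ + 1 = 0)
    (f : MvPolynomial (Fin 5) k) (hf : f = X 4 ^ c + X 0 ^ a₀ + X 1 ^ a₁ + X 2 ^ a₂ + X 3 ^ a₃) : Prime f := by
  set e : MvPolynomial (Fin 5) k ≃+* Polynomial (MvPolynomial (Fin 4) k) :=
    ((renameEquiv k (_root_.finRotate 5)).trans (finSuccEquiv k 4)).toRingEquiv with he_def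
  have hrot4 : (_root_.finRotate 5) (4 : Fin 5) = 0 := by decide
  have hrot : ∀ j : Fin 4, (_root_.finRotate 5) (Fin.castSucc j) = j.succ := by decide
  have he4 : e (X 4) = Polynomial.X := by
    show finSuccEquiv k 4 (rename _ (X 4)) = _
    rw [rename_X, hrot4]; exact finSuccEquiv_X_zero
  have hej : ∀ j : Fin 4, e (X (Fin.castSucc j)) = Polynomial.C (X j) := fun j => by
    show finSuccEquiv k 4 (rename _ (X (Fin.castSucc j))) = _
    rw [rename_X, hrot j]; exact finSuccEquiv_X_succ (j := j)
  set s : MvPolynomial (Fin 4) k := X 0 ^ a₀ + X 1 ^ a₁ + X 2 ^ a₂ + X 3 ^ a₃ with hs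
  have hef : e f = Polynomial.X ^ c + Polynomial.C s := by
    rw [hf, map_add, map_add, map_add, map_add, map_pow, he4, map_pow, map_pow, map_pow, map_pow,
      show (0 : Fin 5) = Fin.castSucc (0 : Fin 4) from rfl, show (1 : Fin 5) = Fin.castSucc (1 : Fin 4) from rfl,
      show (2 : Fin 5) = Fin.castSucc (2 : Fin 4) from rfl, show (3 : Fin 5) = Fin.castSucc (3 : Fin 4) from rfl, hej, hej, hej, hej, hs]
    simp only [map_add, map_pow]
    ring
  set q : Fin 4 → k := ![1, ω, 0, 0] with hq
  have hsq : MvPolynomial.eval q s = 0 := by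
    rw [hs]
    simp only [map_add, map_pow, eval_X, hq, Matrix.cons_val_zero, Matrix.cons_val_one]
    simp only [Matrix.cons_val, one_pow, zero_pow (by omega : a₂ ≠ 0), zero_pow (by omega : a₃ ≠ 0), add_zero]
    linear_combination hω
  have hder : MvPolynomial.eval q (pderiv 0 s) ≠ 0 := by
    have e1 : pderiv 0 s = (a₀ : MvPolynomial (Fin 4) k) * X 0 ^ (a₀ - 1) := by
      rw [hs, map_add, map_add, map_add, pderiv_pow, pderiv_X_self, pderiv_pow, pderiv_X_of_ne (show (1 : Fin 4) ≠ 0 by decide),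
        pderiv_pow, pderiv_X_of_ne (show (2 : Fin 4) ≠ 0 by decide), pderiv_pow, pderiv_X_of_ne (show (3 : Fin 4) ≠ 0 by decide)]
      simp only [mul_one, mul_zero, add_zero]
    rw [e1, map_mul, map_pow, eval_X, hq]
    simp only [Matrix.cons_val_zero, one_pow, mul_one, map_natCast]
    exact ha₀
  have hirr : Irreducible (e f) := by
    rw [hef]
    exact Literature.AlgebraicGeometry.Motives.SmoothHypersurface.irreducible_X_pow_add_C (d := c) (by omega) s q hsq 0 hder
  exact (MulEquiv.prime_iff e).mp hirr.prime

/-- **`(k[X]/(f))_P` is regular at every prime `P ⊉ (x̄, ȳ, ū, t̄, z̄)`** when `a₀, a₁, a₂, a₃ ≠ 0` in `k` (`c ≥ 1`): if some `X_j ∉ P` with `j ≤ 3` then `∂f/∂X_j = a_j·X_j^{a_j−1} ∉ P`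
(Jacobian criterion, `HypersurfaceRegular.stub_hypersurfaceRegularOfPderiv`); otherwise `x, y, u, t ∈ P` and `f ∈ P` force `z^c ∈ P`, `z ∈ P`, `𝔪 ≤ P` — excluded. The derivative
`∂f/∂z = c z^{c−1}` is never used, so `p ∣ c` is allowed. [cite: Hartshorne1977, I Thm. 5.1] -/
theorem regular_off_vertex (c a₀ a₁ a₂ a₃ : ℕ) (hc : 2 ≤ c) (h₀ : c < a₀) (h₁ : c < a₁) (h₂ : c < a₂) (h₃ : c < a₃)
    (ha₀ : ((a₀ : ℕ) : k) ≠ 0) (ha₁ : ((a₁ : ℕ) : k) ≠ 0) (ha₂ : ((a₂ : ℕ) : k) ≠ 0) (ha₃ : ((a₃ : ℕ) : k) ≠ 0) (f : MvPolynomial (Fin 5) k)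
    (hf : f = X 4 ^ c + X 0 ^ a₀ + X 1 ^ a₁ + X 2 ^ a₂ + X 3 ^ a₃)
    (P : Ideal (MvPolynomial (Fin 5) k ⧸ Ideal.span {f})) [P.IsPrime]
    (hP : ¬ Ideal.span (Set.range fun j : Fin 5 => Ideal.Quotient.mk (Ideal.span {f}) (X j)) ≤ P) :
    IsRegularLocalRing (Localization.AtPrime P) := by
  have hP' : (P.comap (Ideal.Quotient.mk (Ideal.span {f}))).IsPrime := Ideal.comap_isPrime _ _
  set P' := P.comap (Ideal.Quotient.mk (Ideal.span {f})) with hP'def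
  have hfP : f ∈ P' := by
    rw [hP'def, Ideal.mem_comap, Ideal.Quotient.eq_zero_iff_mem.mpr (Ideal.mem_span_singleton_self f)]
    exact P.zero_mem
  -- some variable OTHER THAN `z` misses `P'`
  have hex : ∃ j : Fin 5, j ≠ 4 ∧ (X j : MvPolynomial (Fin 5) k) ∉ P' := by
    by_contra hall
    push Not at hall
    apply hP
    have hs : (X 0 : MvPolynomial (Fin 5) k) ^ a₀ + X 1 ^ a₁ + X 2 ^ a₂ + X 3 ^ a₃ ∈ P' :=
      add_mem (add_mem (add_mem (Ideal.pow_mem_of_mem P' (hall 0 (by decide)) a₀ (by omega))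
        (Ideal.pow_mem_of_mem P' (hall 1 (by decide)) a₁ (by omega))) (Ideal.pow_mem_of_mem P' (hall 2 (by decide)) a₂ (by omega)))
        (Ideal.pow_mem_of_mem P' (hall 3 (by decide)) a₃ (by omega))
    have h4c : (X 4 : MvPolynomial (Fin 5) k) ^ c ∈ P' := by
      have e : (X 4 : MvPolynomial (Fin 5) k) ^ c = f - (X 0 ^ a₀ + X 1 ^ a₁ + X 2 ^ a₂ + X 3 ^ a₃) := by rw [hf]; ring
      rw [e]
      exact sub_mem hfP hs
    have h4 : (X 4 : MvPolynomial (Fin 5) k) ∈ P' := hP'.mem_of_pow_mem c h4c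
    rw [Ideal.span_le]
    rintro _ ⟨j, rfl⟩
    by_cases hj : j = 4
    · subst hj; exact h4
    · exact hall j hj
  obtain ⟨j, hj4, hj⟩ := hex
  have hCne : ∀ b : ℕ, ((b : ℕ) : k) ≠ 0 → (C ((b : ℕ) : k) : MvPolynomial (Fin 5) k) ∉ P' := fun b hb h =>
    hP'.ne_top ((Ideal.eq_top_iff_one _).mpr (by
      have hu : IsUnit (C ((b : ℕ) : k) : MvPolynomial (Fin 5) k) := (isUnit_iff_ne_zero.mpr hb).map C
      exact (Ideal.unit_mul_mem_iff_mem _ hu).mp (by simpa using h)))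
  obtain ⟨e0, e1, e2, e3⟩ := pderiv_pow_f k c a₀ a₁ a₂ a₃ f hf
  rcases eq_cube_index_of_ne_four j hj4 with rfl | rfl | rfl | rfl
  · refine HypersurfaceRegular.stub_hypersurfaceRegularOfPderiv k 5 f 0 P ?_
    rw [e0, show ((a₀ : ℕ) : MvPolynomial (Fin 5) k) = C ((a₀ : ℕ) : k) from (map_natCast C a₀).symm]
    exact fun h => (hP'.mem_or_mem h).elim (hCne a₀ ha₀) fun h' => hj (hP'.mem_of_pow_mem (a₀ - 1) h')
  · refine HypersurfaceRegular.stub_hypersurfaceRegularOfPderiv k 5 f 1 P ?_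
    rw [e1, show ((a₁ : ℕ) : MvPolynomial (Fin 5) k) = C ((a₁ : ℕ) : k) from (map_natCast C a₁).symm]
    exact fun h => (hP'.mem_or_mem h).elim (hCne a₁ ha₁) fun h' => hj (hP'.mem_of_pow_mem (a₁ - 1) h')
  · refine HypersurfaceRegular.stub_hypersurfaceRegularOfPderiv k 5 f 2 P ?_
    rw [e2, show ((a₂ : ℕ) : MvPolynomial (Fin 5) k) = C ((a₂ : ℕ) : k) from (map_natCast C a₂).symm]
    exact fun h => (hP'.mem_or_mem h).elim (hCne a₂ ha₂) fun h' => hj (hP'.mem_of_pow_mem (a₂ - 1) h')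
  · refine HypersurfaceRegular.stub_hypersurfaceRegularOfPderiv k 5 f 3 P ?_
    rw [e3, show ((a₃ : ℕ) : MvPolynomial (Fin 5) k) = C ((a₃ : ℕ) : k) from (map_natCast C a₃).symm]
    exact fun h => (hP'.mem_or_mem h).elim (hCne a₃ ha₃) fun h' => hj (hP'.mem_of_pow_mem (a₃ - 1) h')

/-- `f ∉ (X i)` for every variable (`f(e_z) = 1`; `f(1,0,0,0,0) = 1`; `c, a_j ≠ 0`). [certificate] -/
theorem f_not_mem_span_X (c a₀ a₁ a₂ a₃ : ℕ) (hc : 2 ≤ c) (h₀ : c < a₀) (h₁ : c < a₁) (h₂ : c < a₂) (h₃ : c < a₃) (f : MvPolynomial (Fin 5) k)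
    (hf : f = X 4 ^ c + X 0 ^ a₀ + X 1 ^ a₁ + X 2 ^ a₂ + X 3 ^ a₃) (i : Fin 5) :
    f ∉ Ideal.span {(X i : MvPolynomial (Fin 5) k)} := by
  have hc0 : c ≠ 0 := by omega
  have ha0 : a₀ ≠ 0 := by omega
  have ha1 : a₁ ≠ 0 := by omega
  have ha2 : a₂ ≠ 0 := by omega
  have ha3 : a₃ ≠ 0 := by omega
  intro h
  obtain ⟨c', hc'⟩ := Ideal.mem_span_singleton.mp h
  by_cases hi : i = 4
  · subst hi
    have := congrArg (MvPolynomial.eval ![(1 : k), 0, 0, 0, 0]) hc'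
    rw [hf] at this
    simp [zero_pow hc0, zero_pow ha1, zero_pow ha2, zero_pow ha3] at this
  · have := congrArg (MvPolynomial.eval (Pi.single 4 1 : Fin 5 → k)) hc'
    rw [hf] at this
    simp [hi, zero_pow ha0, zero_pow ha1, zero_pow ha2, zero_pow ha3] at this

/-- No variable vanishes on `X`: `x̄_j ≠ 0` in `k[X]/(f)`. [folklore] -/
theorem mk_X_ne_zero (c a₀ a₁ a₂ a₃ : ℕ) (hc : 2 ≤ c) (h₀ : c < a₀) (h₁ : c < a₁) (h₂ : c < a₂) (h₃ : c < a₃) (ha₀ : ((a₀ : ℕ) : k) ≠ 0)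
    (ω : k) (hω : ω ^ a₁ + 1 = 0) (f : MvPolynomial (Fin 5) k) (hf : f = X 4 ^ c + X 0 ^ a₀ + X 1 ^ a₁ + X 2 ^ a₂ + X 3 ^ a₃) (j : Fin 5) :
    Ideal.Quotient.mk (Ideal.span {f}) (X j) ≠ 0 := fun h0 =>
  PrimeTransfer.X_not_mem_span_of_isPrime
    ((Ideal.span_singleton_prime (prime_f k c a₀ a₁ a₂ a₃ hc h₂ h₃ ha₀ ω hω f hf).ne_zero).mpr (prime_f k c a₀ a₁ a₂ a₃ hc h₂ h₃ ha₀ ω hω f hf))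
    (f_not_mem_span_X k c a₀ a₁ a₂ a₃ hc h₀ h₁ h₂ h₃ f hf j) (Ideal.Quotient.eq_zero_iff_mem.mp h0)

/-- The vertex is NOT regular: `f(0) = 0`, `∇f(0) = 0` (`c ≥ 2`, `a_j ≥ 2`). [cite: Hartshorne1977, I Thm. 5.1] -/
theorem vertex_not_mem_regularLocus (c a₀ a₁ a₂ a₃ : ℕ) (hc : 2 ≤ c) (h₀ : c < a₀) (h₁ : c < a₁) (h₂ : c < a₂) (h₃ : c < a₃) (ha₀ : ((a₀ : ℕ) : k) ≠ 0)
    (ω : k) (hω : ω ^ a₁ + 1 = 0) (f : MvPolynomial (Fin 5) k) (hf : f = X 4 ^ c + X 0 ^ a₀ + X 1 ^ a₁ + X 2 ^ a₂ + X 3 ^ a₃)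
    (v : Spec (.of (MvPolynomial (Fin 5) k ⧸ Ideal.span {f})))
    (hv : v.asIdeal = Ideal.span (Set.range fun j : Fin 5 => Ideal.Quotient.mk (Ideal.span {f}) (X j))) :
    v ∉ Scheme.regularLocus (Spec (.of (MvPolynomial (Fin 5) k ⧸ Ideal.span {f}))) := by
  classical
  obtain ⟨e0, e1, e2, e3⟩ := pderiv_pow_f k c a₀ a₁ a₂ a₃ f hf
  refine not_mem_regularLocus_Spec_of_not_isRegularLocalRing v ?_
  refine not_isRegularLocalRing_localization_of_pderiv_eval_eq_zero (0 : Fin 5 → k) (prime_f k c a₀ a₁ a₂ a₃ hc h₂ h₃ ha₀ ω hω f hf).ne_zero ?_ ?_ v.asIdeal ?_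
  · rw [MvPolynomial.eval_zero]
    exact constantCoeff_f k c a₀ a₁ a₂ a₃ hc h₀ h₁ h₂ h₃ f hf
  · intro i
    by_cases hi4 : i = 4
    · subst hi4
      rw [pderiv_four_f k c a₀ a₁ a₂ a₃ f hf, map_mul, map_pow, MvPolynomial.eval_X, Pi.zero_apply, zero_pow (by omega : c - 1 ≠ 0), mul_zero]
    · rcases eq_cube_index_of_ne_four i hi4 with rfl | rfl | rfl | rfl
      · rw [e0, map_mul, map_pow, MvPolynomial.eval_X, Pi.zero_apply, zero_pow (by omega : a₀ - 1 ≠ 0), mul_zero]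
      · rw [e1, map_mul, map_pow, MvPolynomial.eval_X, Pi.zero_apply, zero_pow (by omega : a₁ - 1 ≠ 0), mul_zero]
      · rw [e2, map_mul, map_pow, MvPolynomial.eval_X, Pi.zero_apply, zero_pow (by omega : a₂ - 1 ≠ 0), mul_zero]
      · rw [e3, map_mul, map_pow, MvPolynomial.eval_X, Pi.zero_apply, zero_pow (by omega : a₃ - 1 ≠ 0), mul_zero]
  · rw [hv, DoublePointFermatCubicGerm.comap_origin k f (constantCoeff_f k c a₀ a₁ a₂ a₃ hc h₀ h₁ h₂ h₃ f hf), MvPolynomial.eval_zero, Fedder.span_range_X_eq_ker]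

/-! ## §2 Support, convenience, weak non-degeneracy -/

/-- `f` as a sum of five monomials. [plumbing] -/
theorem eq_monomials (c a₀ a₁ a₂ a₃ : ℕ) (f : MvPolynomial (Fin 5) k) (hf : f = X 4 ^ c + X 0 ^ a₀ + X 1 ^ a₁ + X 2 ^ a₂ + X 3 ^ a₃) :
    f = monomial (Finsupp.single 4 c) 1 + monomial (Finsupp.single 0 a₀) 1 + monomial (Finsupp.single 1 a₁) 1 +
      monomial (Finsupp.single 2 a₂) 1 + monomial (Finsupp.single 3 a₃) 1 := by
  rw [hf]; simp only [X_pow_eq_monomial]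

/-- The support of `f` consists of the five pure powers. [plumbing] -/
theorem mem_support_f (c a₀ a₁ a₂ a₃ : ℕ) (f : MvPolynomial (Fin 5) k) (hf : f = X 4 ^ c + X 0 ^ a₀ + X 1 ^ a₁ + X 2 ^ a₂ + X 3 ^ a₃) :
    ∀ α ∈ f.support, α = Finsupp.single 4 c ∨ α = Finsupp.single 0 a₀ ∨ α = Finsupp.single 1 a₁ ∨ α = Finsupp.single 2 a₂ ∨ α = Finsupp.single 3 a₃ := by
  classical
  intro α hα
  rw [eq_monomials k c a₀ a₁ a₂ a₃ f hf] at hα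
  rcases mem_support_add5 hα with h | h | h | h | h
  · exact Or.inl (eq_of_mem_support_monomial h)
  · exact Or.inr (Or.inl (eq_of_mem_support_monomial h))
  · exact Or.inr (Or.inr (Or.inl (eq_of_mem_support_monomial h)))
  · exact Or.inr (Or.inr (Or.inr (Or.inl (eq_of_mem_support_monomial h))))
  · exact Or.inr (Or.inr (Or.inr (Or.inr (eq_of_mem_support_monomial h))))

/-- ★ **`f` is CONVENIENT**: every variable occurs as a pure power with non-zero coefficient (`z^c`, `X_j^{a_j}`; `c, a_j ≠ 0`) — the hypothesis of ✓ `F108ClassRow.F108Consumable`.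
[folklore] -/
theorem convenient_f (c a₀ a₁ a₂ a₃ : ℕ) (hc : 2 ≤ c) (h₀ : c < a₀) (h₁ : c < a₁) (h₂ : c < a₂) (h₃ : c < a₃) (f : MvPolynomial (Fin 5) k)
    (hf : f = X 4 ^ c + X 0 ^ a₀ + X 1 ^ a₁ + X 2 ^ a₂ + X 3 ^ a₃) :
    ∀ j : Fin 5, ∃ N : ℕ, 0 < N ∧ MvPolynomial.coeff (Finsupp.single j N) f ≠ 0 := by
  classical
  have hc0 : c ≠ 0 := by omega
  have ha0 : a₀ ≠ 0 := by omega
  have ha1 : a₁ ≠ 0 := by omega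
  have ha2 : a₂ ≠ 0 := by omega
  have ha3 : a₃ ≠ 0 := by omega
  intro j
  rw [eq_monomials k c a₀ a₁ a₂ a₃ f hf]
  fin_cases j
  · exact ⟨a₀, Nat.pos_of_ne_zero ha0, by simp [coeff_monomial, Finsupp.single_eq_single_iff, ha0]⟩
  · exact ⟨a₁, Nat.pos_of_ne_zero ha1, by simp [coeff_monomial, Finsupp.single_eq_single_iff, ha1]⟩
  · exact ⟨a₂, Nat.pos_of_ne_zero ha2, by simp [coeff_monomial, Finsupp.single_eq_single_iff, ha2]⟩
  · exact ⟨a₃, Nat.pos_of_ne_zero ha3, by simp [coeff_monomial, Finsupp.single_eq_single_iff, ha3]⟩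
  · exact ⟨c, Nat.pos_of_ne_zero hc0, by simp [coeff_monomial, Finsupp.single_eq_single_iff, hc0]⟩

/-- ★ **`f = z^c + x^{a₀} + y^{a₁} + u^{a₂} + t^{a₃}` IS WEAKLY NON-DEGENERATE ALONG EVERY POSITIVE WEIGHT** when `a₀, a₁, a₂, a₃ ≠ 0` in `k` (`β₀ = c·e_z`, the possibly
Jacobian-degenerate vertex — no hypothesis on `c`; good exponents `a_j·e_j`, `j < 4`: private variables with exponent `a_j ≢ 0`). One application of res-L1-w45a-stub-3's
✓ `weaklyNondegenerate_of_good_support`. [OURS · elementary certificate; cite: BoubakriGreuelMarkwig2010, §3 (p. 10)] -/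
theorem weaklyNondegenerate_f (c a₀ a₁ a₂ a₃ : ℕ) (ha₀ : ((a₀ : ℕ) : k) ≠ 0) (ha₁ : ((a₁ : ℕ) : k) ≠ 0) (ha₂ : ((a₂ : ℕ) : k) ≠ 0) (ha₃ : ((a₃ : ℕ) : k) ≠ 0)
    (f : MvPolynomial (Fin 5) k) (hf : f = X 4 ^ c + X 0 ^ a₀ + X 1 ^ a₁ + X 2 ^ a₂ + X 3 ^ a₃) :
    ∀ w : Fin 5 → ℝ, (∀ i, 0 < w i) → IsWeaklyNondegenerateAlong w (f : MvPowerSeries (Fin 5) k) := by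
  classical
  have ha0 : a₀ ≠ 0 := fun h => ha₀ (by simp [h])
  have hf0 : f ≠ 0 := by
    -- the coefficient of `x^{a₀}` is `1` (`a₀ ≠ 0`, so no other pure power coincides with it)
    intro h0
    have := congrArg (MvPolynomial.coeff (Finsupp.single (0 : Fin 5) a₀)) h0
    rw [eq_monomials k c a₀ a₁ a₂ a₃ f hf] at this
    simp [coeff_monomial, Finsupp.single_eq_single_iff, ha0] at this
  have hsupp := mem_support_f k c a₀ a₁ a₂ a₃ f hf
  refine weaklyNondegenerate_of_good_support f hf0 (Finsupp.single 4 c) (fun α hα hne => ?_)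
  rcases hsupp α hα with rfl | rfl | rfl | rfl | rfl
  · exact (hne rfl).elim
  · refine ⟨0, by simpa using ha₀, fun β hβ hβne => ?_⟩
    rcases hsupp β hβ with rfl | rfl | rfl | rfl | rfl
    · simp
    · exact (hβne rfl).elim
    · simp
    · simp
    · simp
  · refine ⟨1, by simpa using ha₁, fun β hβ hβne => ?_⟩
    rcases hsupp β hβ with rfl | rfl | rfl | rfl | rfl
    · simp
    · simp
    · exact (hβne rfl).elim
    · simp
    · simp
  · refine ⟨2, by simpa using ha₂, fun β hβ hβne => ?_⟩
    rcases hsupp β hβ with rfl | rfl | rfl | rfl | rfl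
    · simp
    · simp
    · simp
    · exact (hβne rfl).elim
    · simp
  · refine ⟨3, by simpa using ha₃, fun β hβ hβne => ?_⟩
    rcases hsupp β hβ with rfl | rfl | rfl | rfl | rfl
    · simp
    · simp
    · simp
    · simp
    · exact (hβne rfl).elim

end Summit.ResolutionOfSingularities.ResolutionOfSingularities.Theorems.FInjectiveMacaulayfication.BrieskornPhamSpecimen

end
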